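import Summits.AtomisticToContinuum.Crystallization.Theorems.ChargedEnergyGapRegistryRigidityA
import HarnessLib

/-!
# ChargedEnergyGap · «RegistryRigidity» ([VIR] / [VIR-sum] / [VIR-red] / [VIR-fub]; lens-3 g67 f43fb237) — part 2 of 2 (sequel of `…ChargedEnergyGapRegistryRigidityA`)

Split for the 400-line cap by the landing lane (hand-2 g34); the module docstring of part 1 (`…ChargedEnergyGapRegistryRigidityA`) describes the whole node.  Same namespace; all FQNs unchanged.
0 sorry; standard axioms.
-/

noncomputable section
open scoped Classical
open Literature.MathematicalPhysics.StatisticalMechanics Literature.Geometry.DiscreteGeometry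
open Summit.AtomisticToContinuum.Crystallization.Theses.PricedLinkCensus
open Summit.AtomisticToContinuum.Crystallization.Theorems.ChargedEnergyGapNegative

namespace Summit.AtomisticToContinuum.Crystallization.Theorems.ChargedEnergyGapChartDial

/-! ## §V4 ★★ [VIR] PROVED from [VIR-fub] (summability of ONE explicit `ℤ³` family): pull back, re-index by `ℤ³`, regroup by layers -/

section LayerRegrouping

variable {P : PeriodicConfiguration 3}

/-- ★ PULL-BACK of the site virial through a rigid presentation `P.points = L '' S + c`: the site virial at `L y + c` in the directions
`L a`, `L b` is the same absolutely convergent sum written over `S ∖ {y}` (cf. `siteVirial_symm`, the case `S = P.points`). -/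
theorem siteVirial_presentation {S : Set E3} (L : E3 ≃ₗᵢ[ℝ] E3) (c : E3) (hP : P.points = (fun x => L x + c) '' S) (y a b : E3) :
    siteVirial P (L y + c) (L a) (L b) =
      ∑' w : {w : E3 // w ∈ S ∧ w ≠ y}, ljD1 (dist y w) / dist y (w : E3) * (inner ℝ ((w : E3) - y) a * inner ℝ ((w : E3) - y) b) := by
  unfold siteVirial
  have hmem : ∀ p : E3, L p + c ∈ P.points ↔ p ∈ S := fun p => by
    rw [hP]
    constructor
    · rintro ⟨q, hq, hq'⟩
      have : q = p := L.injective (add_right_cancel hq')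
      subst this
      exact hq
    · exact fun hp => ⟨p, hp, rfl⟩
  let e : {w : E3 // w ∈ S ∧ w ≠ y} ≃ {z : E3 // z ∈ P.points ∧ z ≠ L y + c} :=
    { toFun := fun w => ⟨L w + c, (hmem w).2 w.2.1, fun h => w.2.2 (L.injective (add_right_cancel h))⟩
      invFun := fun z => ⟨L.symm (z - c), by
          have h1 : L (L.symm ((z : E3) - c)) + c = z := by simp
          exact ⟨(hmem _).1 (by rw [h1]; exact z.2.1), fun h => z.2.2 (by rw [← h1, h])⟩⟩
      left_inv := fun w => by ext1; simp
      right_inv := fun z => by ext1; simp }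
  rw [← e.tsum_eq]
  refine tsum_congr fun w => ?_
  have hd : dist (L y + c) (L (w : E3) + c) = dist y (w : E3) := by rw [dist_add_right, L.dist_map]
  have hv : L (w : E3) + c - (L y + c) = L ((w : E3) - y) := by rw [map_sub]; abel
  change ljD1 (dist (L y + c) (L (w : E3) + c)) / dist (L y + c) (L (w : E3) + c) *
      (inner ℝ (L (w : E3) + c - (L y + c)) (L a) * inner ℝ (L (w : E3) + c - (L y + c)) (L b)) = _
  rw [hd, hv, L.inner_map_map, L.inner_map_map]

/-- `barlowPos` is injective on `ℤ³` for `a, h > 0` (uniform discreteness `le_dist_barlowPos`). -/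
theorem barlowPos_injective {a h : ℝ} (ha : 0 < a) (hh : 0 < h) (s : ℤ → ℤ) :
    Function.Injective fun t : ℤ × ℤ × ℤ => barlowPos a h s t.1 t.2.1 t.2.2 := by
  intro t t' heq
  by_contra hne
  have h1 := le_dist_barlowPos a h s ha.le hh.le (k := t.1) (i := t.2.1) (j := t.2.2) (k' := t'.1) (i' := t'.2.1) (j' := t'.2.2)
    (fun h0 => hne (by
      simp only [Prod.mk.injEq] at h0
      exact Prod.ext h0.1 (Prod.ext h0.2.1 h0.2.2)))
  simp only at heq
  rw [heq, dist_self] at h1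
  exact absurd h1 (not_le.mpr (lt_min ha hh))

/-- `ℤ³ ≃` the Barlow stacking, `t ↦ barlowPos a h s t`. -/
def barlowEquiv {a h : ℝ} (ha : 0 < a) (hh : 0 < h) (s : ℤ → ℤ) : (ℤ × ℤ × ℤ) ≃ barlowStacking a h s :=
  Equiv.ofBijective (fun t => ⟨barlowPos a h s t.1 t.2.1 t.2.2, barlowPos_mem t.1 t.2.1 t.2.2⟩)
    ⟨fun t t' h0 => barlowPos_injective ha hh s (congrArg Subtype.val h0), fun x => by
      obtain ⟨k, i, j, hx⟩ := x.2
      exact ⟨(k, i, j), Subtype.ext hx.symm⟩⟩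

/-- RE-INDEXING a sum over the punctured stacking `S ∖ {y}`, `y = barlowPos m i₀ j₀`, by `ℤ³` (the missing term is `0`). -/
theorem tsum_barlowStacking_punctured {a h : ℝ} (ha : 0 < a) (hh : 0 < h) (s : ℤ → ℤ) (m i₀ j₀ : ℤ) (F : E3 → ℝ)
    (hF : F (barlowPos a h s m i₀ j₀) = 0) :
    ∑' w : {w : E3 // w ∈ barlowStacking a h s ∧ w ≠ barlowPos a h s m i₀ j₀}, F w =
      ∑' t : ℤ × ℤ × ℤ, F (barlowPos a h s t.1 t.2.1 t.2.2) := by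
  set y := barlowPos a h s m i₀ j₀ with hy
  have hsupp1 : Function.support ((barlowStacking a h s).indicator F) ⊆ {w | w ∈ barlowStacking a h s ∧ w ≠ y} := by
    intro w hw
    rw [Function.mem_support] at hw
    refine ⟨Set.mem_of_indicator_ne_zero hw, fun hwy => hw ?_⟩
    rw [hwy, Set.indicator_of_mem (barlowPos_mem m i₀ j₀)]
    exact hF
  have hsupp2 : Function.support ((barlowStacking a h s).indicator F) ⊆ barlowStacking a h s :=
    Set.support_indicator_subset
  have h1 : ∑' w : {w : E3 // w ∈ barlowStacking a h s ∧ w ≠ y}, F w =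
      ∑' w : {w : E3 // w ∈ barlowStacking a h s ∧ w ≠ y}, (barlowStacking a h s).indicator F w :=
    tsum_congr fun w => (Set.indicator_of_mem w.2.1 F).symm
  have h2 : ∑' w : barlowStacking a h s, F w = ∑' w : barlowStacking a h s, (barlowStacking a h s).indicator F w :=
    tsum_congr fun w => (Set.indicator_of_mem w.2 F).symm
  have h3 : ∑' w : {w : E3 // w ∈ barlowStacking a h s ∧ w ≠ y}, (barlowStacking a h s).indicator F w =
      ∑' w : E3, (barlowStacking a h s).indicator F w :=
    tsum_subtype_eq_of_support_subset hsupp1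
  have h4 : ∑' w : barlowStacking a h s, (barlowStacking a h s).indicator F w = ∑' w : E3, (barlowStacking a h s).indicator F w :=
    tsum_subtype_eq_of_support_subset hsupp2
  rw [h1, h3, ← h4, ← h2, ← (barlowEquiv ha hh s).tsum_eq]
  rfl

/-- The layer normal as a coordinate vector: `⟪x, e₃⟫ = x₂` with `e₃ = layerNormal 1`. -/
theorem inner_layerNormal_one (x : E3) : inner ℝ x (layerNormal 1) = x 2 := by
  have : layerNormal 1 = EuclideanSpace.single (2 : Fin 3) (1 : ℝ) := by
    ext i; fin_cases i <;> simp [layerNormal]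
  rw [this, EuclideanSpace.inner_single_right]
  simp

/-- THE `ℤ³` FAMILY of the normal–normal site virial of `barlowStacking a h s` at the site `barlowPos m i₀ j₀`:
`T(k, i, j) = φ(‖z − y‖)·((k − m)h)²`, `φ(r) = V′(r)/r`, `z = barlowPos k i j`. -/
def virialTermNN (a h : ℝ) (s : ℤ → ℤ) (m i₀ j₀ : ℤ) (t : ℤ × ℤ × ℤ) : ℝ :=
  ljD1 ‖barlowPos a h s t.1 t.2.1 t.2.2 - barlowPos a h s m i₀ j₀‖ / ‖barlowPos a h s t.1 t.2.1 t.2.2 - barlowPos a h s m i₀ j₀‖ *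
    ((((t.1 : ℝ) - m) * h) * (((t.1 : ℝ) - m) * h))

/-- ★ piece [VIR-fub] · UNDECIDED · TRUE · ANALYTIC-S (CERT-able) · **ABSOLUTE SUMMABILITY OF THE SITE-VIRIAL FAMILY OVER `ℤ³`**: for `a, h > 0`
the family `virialTermNN a h s m i₀ j₀` is summable (`|T| ≤ (d⁻¹² + d⁻⁶)`, `d ≥ min a h` off the site, `d² ≳ |t|²` after absorbing the layer
labels — the content of `summable_virial` transported to the index set).  Why it might fail: it cannot; it is the Fubini licence for [VIR]. -/
def BarlowVirialSummable : Prop :=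
  ∀ (a h : ℝ) (s : ℤ → ℤ) (m i₀ j₀ : ℤ), 0 < a → 0 < h → Summable (virialTermNN a h s m i₀ j₀)

/-- ★ The normal–normal site virial of a rigid Barlow presentation at a lattice site IS the `ℤ³` sum of `virialTermNN`. -/
theorem siteVirial_barlow_eq_tsum {a h : ℝ} {s : ℤ → ℤ} (L : E3 ≃ₗᵢ[ℝ] E3) (c : E3) (ha : 0 < a) (hh : 0 < h)
    (hP : P.points = (fun x => L x + c) '' barlowStacking a h s) (m i₀ j₀ : ℤ) :
    siteVirial P (L (barlowPos a h s m i₀ j₀) + c) (L (layerNormal 1)) (L (layerNormal 1)) =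
      ∑' t : ℤ × ℤ × ℤ, virialTermNN a h s m i₀ j₀ t := by
  rw [siteVirial_presentation L c hP]
  rw [tsum_barlowStacking_punctured ha hh s m i₀ j₀
    (fun w => ljD1 (dist (barlowPos a h s m i₀ j₀) w) / dist (barlowPos a h s m i₀ j₀) w *
      (inner ℝ (w - barlowPos a h s m i₀ j₀) (layerNormal 1) * inner ℝ (w - barlowPos a h s m i₀ j₀) (layerNormal 1))) (by simp)]
  refine tsum_congr fun t => ?_
  simp only [virialTermNN, inner_layerNormal_one, PiLp.sub_apply, barlowPos_apply_two, dist_eq_norm', sub_mul]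

/-- `layerSumNN` vanishes at height `0` (the factor `(0·h)²`). -/
theorem layerSumNN_zero (a h : ℝ) (t : ℤ) : layerSumNN a h 0 t = 0 := by
  unfold layerSumNN
  simp

/-- The shifted class `t = 2` gives the same layer sum as `t = −1` (re-index `p ↦ p + (1,1)`; `2w = u + v − w`), hence as `t = 1`. -/
theorem layerSumNN_two (a h : ℝ) (j : ℕ) : layerSumNN a h j 2 = layerSumNN a h j 1 := by
  rw [← layerSumNN_neg_one]
  unfold layerSumNN
  conv_rhs => rw [← ((Equiv.addRight (1 : ℤ)).prodCongr (Equiv.addRight (1 : ℤ))).tsum_eq]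
  refine tsum_congr fun p => ?_
  have key : ‖((((Equiv.addRight (1 : ℤ)).prodCongr (Equiv.addRight (1 : ℤ)) p).1 : ℤ) : ℝ) • triangularVec₁ a +
        ((((Equiv.addRight (1 : ℤ)).prodCongr (Equiv.addRight (1 : ℤ)) p).2 : ℤ) : ℝ) • triangularVec₂ a +
        ((-1 : ℤ) : ℝ) • barlowOffset a + (j : ℝ) • layerNormal h‖ =
      ‖(p.1 : ℝ) • triangularVec₁ a + (p.2 : ℝ) • triangularVec₂ a + ((2 : ℤ) : ℝ) • barlowOffset a + (j : ℝ) • layerNormal h‖ := by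
    rw [EuclideanSpace.norm_eq, EuclideanSpace.norm_eq]
    congr 1
    simp only [Fin.sum_univ_three, Equiv.prodCongr_apply, Prod.map_fst, Prod.map_snd, Equiv.coe_addRight, Int.cast_add, Int.cast_one,
      Int.cast_neg, Int.cast_ofNat, triangularVec₁, triangularVec₂, barlowOffset, layerNormal, PiLp.add_apply, PiLp.smul_apply, smul_eq_mul,
      Real.norm_eq_abs, sq_abs]
    simp
    ring
  rw [key]

/-- The layer sum depends on the class only through `t mod 3 ∈ {0} ∪ {1, 2}`: for a residue `r = Δ % 3`,
`layerSumNN a h j r = if r = 0 then (in registry) else (shifted)`. -/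
theorem layerSumNN_emod_three (a h : ℝ) (j : ℕ) (Δ : ℤ) :
    layerSumNN a h j (Δ % 3) = if Δ % 3 = 0 then layerSumNN a h j 0 else layerSumNN a h j 1 := by
  have h0 : 0 ≤ Δ % 3 := Int.emod_nonneg Δ (by norm_num)
  have h3 : Δ % 3 < 3 := Int.emod_lt_of_pos Δ (by norm_num)
  by_cases hz : Δ % 3 = 0
  · rw [if_pos hz, hz]
  · rw [if_neg hz]
    rcases (show Δ % 3 = 1 ∨ Δ % 3 = 2 by omega) with h1 | h2
    · rw [h1]
    · rw [h2, layerSumNN_two]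

/-- ★ PER-LAYER RE-INDEXING (no summability needed): the layer-`k` slice of the `ℤ³` family is the layer sum at height `|k − m|·h` in the registry
class `(haggLabel s k − haggLabel s m) mod 3` — absorb `3q` letters into the in-layer translation `q(u + v)` (`three_smul_barlowOffset`). -/
theorem tsum_layer_virialTermNN (a h : ℝ) (s : ℤ → ℤ) (m i₀ j₀ k : ℤ) :
    ∑' p : ℤ × ℤ, virialTermNN a h s m i₀ j₀ (k, p) =
      layerSumNN a h (k - m).natAbs ((haggLabel s k - haggLabel s m) % 3) := by
  set Δ := haggLabel s k - haggLabel s m with hΔdef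
  set q := Δ / 3 with hq
  set r := Δ % 3 with hr
  have hΔ : (haggLabel s k : ℝ) = haggLabel s m + 3 * q + r := by
    have h2 : (haggLabel s k : ℤ) = haggLabel s m + 3 * q + r := by omega
    exact_mod_cast h2
  have hn : (((k - m).natAbs : ℕ) : ℝ) ^ 2 = ((k : ℝ) - m) ^ 2 := by
    rw [Nat.cast_natAbs, Int.cast_abs, sq_abs]; push_cast; ring
  unfold layerSumNN
  conv_rhs => rw [← ((Equiv.addRight (-i₀ + q)).prodCongr (Equiv.addRight (-j₀ + q))).tsum_eq]
  refine tsum_congr fun p => ?_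
  have key : ‖barlowPos a h s k p.1 p.2 - barlowPos a h s m i₀ j₀‖ =
      ‖((((Equiv.addRight (-i₀ + q)).prodCongr (Equiv.addRight (-j₀ + q)) p).1 : ℤ) : ℝ) • triangularVec₁ a +
        ((((Equiv.addRight (-i₀ + q)).prodCongr (Equiv.addRight (-j₀ + q)) p).2 : ℤ) : ℝ) • triangularVec₂ a +
        (r : ℝ) • barlowOffset a + (((k - m).natAbs : ℕ) : ℝ) • layerNormal h‖ := by
    rw [EuclideanSpace.norm_eq, EuclideanSpace.norm_eq]
    congr 1
    simp only [Fin.sum_univ_three, Equiv.prodCongr_apply, Prod.map_fst, Prod.map_snd, Equiv.coe_addRight, Int.cast_add, Int.cast_neg,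
      triangularVec₁, triangularVec₂, barlowOffset, layerNormal, PiLp.add_apply, PiLp.sub_apply, PiLp.smul_apply, smul_eq_mul,
      Real.norm_eq_abs, sq_abs, barlowPos_apply_zero, barlowPos_apply_one, barlowPos_apply_two]
    simp only [Matrix.cons_val_zero, Matrix.cons_val_one, Matrix.head_cons, Matrix.cons_val_two, Matrix.tail_cons, mul_zero, add_zero]
    rw [hΔ]
    have e3 : (((k - m).natAbs : ℕ) : ℝ) * h * ((((k - m).natAbs : ℕ) : ℝ) * h) = ((k : ℝ) - m) ^ 2 * h ^ 2 := by
      rw [← hn]; ring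
    nlinarith [e3, hn]
  have fac : (((k : ℝ) - m) * h) * (((k : ℝ) - m) * h) = ((((k - m).natAbs : ℕ) : ℝ) * h) ^ 2 := by
    rw [mul_pow, hn]; ring
  show ljD1 ‖barlowPos a h s k p.1 p.2 - barlowPos a h s m i₀ j₀‖ / ‖barlowPos a h s k p.1 p.2 - barlowPos a h s m i₀ j₀‖ *
      ((((k : ℝ) - m) * h) * (((k : ℝ) - m) * h)) = _
  rw [key, fac]

/-- Registry class of layer `m + j` relative to layer `m` = Hägg alignment `HaggAligned s m j`. -/
theorem emod_three_eq_zero_iff_haggAligned_add (s : ℤ → ℤ) (m : ℤ) (j : ℕ) :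
    (haggLabel s (m + j) - haggLabel s m) % 3 = 0 ↔ HaggAligned s m j := by
  rw [haggAligned_iff_haggLabel_modEq, Int.modEq_iff_dvd, Int.dvd_iff_emod_eq_zero]

/-- Registry class of layer `m − j` relative to layer `m` = Hägg alignment `HaggAligned s (m − j) j`. -/
theorem emod_three_eq_zero_iff_haggAligned_sub (s : ℤ → ℤ) (m : ℤ) (j : ℕ) :
    (haggLabel s (m - j) - haggLabel s m) % 3 = 0 ↔ HaggAligned s (m - j) j := by
  rw [haggAligned_iff_haggLabel_modEq, sub_add_cancel, Int.modEq_iff_dvd, dvd_sub_comm, Int.dvd_iff_emod_eq_zero]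

/-- Consecutive layers are never in registry: `alignedPairs s 1 m = 0` for a Hägg word. -/
theorem alignedPairs_one {s : ℤ → ℤ} (hs : IsHaggSeq s) (m : ℤ) : alignedPairs s 1 m = 0 := by
  have h1 : ¬ HaggAligned s m 1 := by
    rw [haggAligned_iff_haggLabel_modEq]; exact_mod_cast not_haggLabel_modEq_succ hs m
  have h2 : ¬ HaggAligned s (m - 1) 1 := by
    rw [haggAligned_iff_haggLabel_modEq]
    have := not_haggLabel_modEq_succ hs (m - 1)
    exact_mod_cast this
  simp [alignedPairs, h1, h2]

/-- ★ THE TWO LAYERS AT RANGE `j`: their contributions add up to `2·(shifted) + n_j(m)·δ_j`. -/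
theorem layer_pair_eq (a h : ℝ) (s : ℤ → ℤ) (m : ℤ) (j : ℕ) :
    layerSumNN a h j ((haggLabel s (m + j) - haggLabel s m) % 3) + layerSumNN a h j ((haggLabel s (m - j) - haggLabel s m) % 3) =
      2 * layerSumNN a h j 1 + (alignedPairs s j m : ℝ) * layerDeltaNN a h j := by
  rw [layerSumNN_emod_three, layerSumNN_emod_three,
    if_congr (emod_three_eq_zero_iff_haggAligned_add s m j) rfl rfl, if_congr (emod_three_eq_zero_iff_haggAligned_sub s m j) rfl rfl]
  unfold alignedPairs layerDeltaNN
  by_cases h1 : HaggAligned s m j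
  · by_cases h2 : HaggAligned s (m - j) j
    · simp only [if_pos h1, if_pos h2]; push_cast; ring
    · simp only [if_pos h1, if_neg h2]; push_cast; ring
  · by_cases h2 : HaggAligned s (m - j) j
    · simp only [if_neg h1, if_pos h2]; push_cast; ring
    · simp only [if_neg h1, if_neg h2]; push_cast; ring

/-- ★★ **[VIR] FROM [VIR-fub] ∧ [VIR-sum]** (PROVED): pull back (`siteVirial_presentation`), re-index by `ℤ³` (`tsum_barlowStacking_punctured`),
Fubini over layers (`Summable.tsum_prod`, licensed by [VIR-fub]), per-layer re-indexing into registry classes (`tsum_layer_virialTermNN`),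
fold `ℤ → ℕ` (`tsum_of_nat_of_neg_add_one`), pair the layers `m ± j` (`layer_pair_eq`), drop `j = 1` (`alignedPairs_one`). -/
theorem layerVirialIdentity_of_summable (hF : BarlowVirialSummable) (hSum : LayerDeltaSummable) : LayerVirialIdentity := by
  intro P a h s L c ha hh hH hP m y hy
  obtain ⟨i₀, j₀, rfl⟩ := hy
  rw [siteVirial_barlow_eq_tsum L c ha hh hP m i₀ j₀]
  have hT : Summable (virialTermNN a h s m i₀ j₀) := hF a h s m i₀ j₀ ha hh
  rw [hT.tsum_prod]
  simp only [tsum_layer_virialTermNN]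
  -- the layer function and its summability
  set g : ℤ → ℝ := fun k => layerSumNN a h (k - m).natAbs ((haggLabel s k - haggLabel s m) % 3) with hg
  have hgs : Summable g := by
    refine hT.prod.congr fun k => ?_
    exact tsum_layer_virialTermNN a h s m i₀ j₀ k
  -- shift the layer index to be relative to `m`, fold `ℤ → ℕ`
  rw [← (Equiv.addLeft m).tsum_eq g]
  simp only [Equiv.coe_addLeft]
  have hfs : Summable fun k : ℤ => g (m + k) := hgs.comp_injective (add_right_injective m)
  have hf1 : Summable fun n : ℕ => g (m + (n : ℤ)) := hfs.comp_injective Nat.cast_injective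
  have hinj : Function.Injective fun n : ℕ => -((n : ℤ) + 1) := fun a b hab => by
    have : (a : ℤ) = b := by
      have h0 : -((a : ℤ) + 1) = -((b : ℤ) + 1) := hab
      linarith
    exact_mod_cast this
  have hf2 : Summable fun n : ℕ => g (m + -((n : ℤ) + 1)) := hfs.comp_injective hinj
  rw [tsum_of_nat_of_neg_add_one (f := fun k : ℤ => g (m + k)) hf1 hf2, hf1.tsum_eq_zero_add]
  have hf0 : g (m + ((0 : ℕ) : ℤ)) = 0 := by
    simp only [hg, Nat.cast_zero, add_zero, sub_self, Int.natAbs_zero]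
    exact layerSumNN_zero a h _
  rw [hf0, zero_add]
  have hf1' : Summable fun n : ℕ => g (m + ((n + 1 : ℕ) : ℤ)) :=
    (summable_nat_add_iff (f := fun n : ℕ => g (m + (n : ℤ))) 1).mpr hf1
  rw [← hf1'.tsum_add hf2]
  -- pair the layers `m ± (n+1)`
  have hpair : ∀ n : ℕ, g (m + ((n + 1 : ℕ) : ℤ)) + g (m + -((n : ℤ) + 1)) =
      2 * layerSumNN a h (n + 1) 1 + (alignedPairs s (n + 1) m : ℝ) * layerDeltaNN a h (n + 1) := by
    intro n
    have e1 : (m + ((n + 1 : ℕ) : ℤ) - m).natAbs = n + 1 := by omega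
    have e2 : (m + -((n : ℤ) + 1) - m).natAbs = n + 1 := by omega
    have e3 : m + -((n : ℤ) + 1) = m - ((n + 1 : ℕ) : ℤ) := by push_cast; ring
    simp only [hg]
    rw [e1, e2, e3]
    exact layer_pair_eq a h s m (n + 1)
  rw [tsum_congr hpair]
  -- split the baseline off (summability of both parts), drop `j = 1`
  have hδ : Summable fun n : ℕ => (alignedPairs s (n + 1) m : ℝ) * layerDeltaNN a h (n + 1) := by
    have h1 : Summable fun n : ℕ => layerDeltaNN a h (n + 1) :=
      (summable_nat_add_iff (f := fun n : ℕ => layerDeltaNN a h n) 1).mpr (hSum a h ha hh)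
    refine Summable.of_norm_bounded (h1.abs.mul_left 2) fun n => ?_
    rw [Real.norm_eq_abs, abs_mul]
    refine mul_le_mul_of_nonneg_right ?_ (abs_nonneg _)
    rw [Nat.abs_cast]
    exact_mod_cast alignedPairs_le_two s (n + 1) m
  have hO : Summable fun n : ℕ => 2 * layerSumNN a h (n + 1) 1 := by
    have hp : Summable fun n : ℕ => 2 * layerSumNN a h (n + 1) 1 + (alignedPairs s (n + 1) m : ℝ) * layerDeltaNN a h (n + 1) :=
      (hf1'.add hf2).congr hpair
    exact (hp.sub hδ).congr fun n => by ring
  rw [hO.tsum_add hδ, tsum_mul_left, hδ.tsum_eq_zero_add, zero_add, alignedPairs_one hH m, Nat.cast_zero, zero_mul, zero_add]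
  simp only [add_assoc, Nat.reduceAdd, baselineNN]

/-- ★★ COROLLARY: [CLS-an] ⟸ [DOM] ∧ [VIR-fub] ∧ [VIR-sum] — all three are summability / interval certificates of explicit lattice sums; no
Hägg-word combinatorics or virial bookkeeping remains. -/
theorem barlowRegistryRigidity_of_dominance_summable (hD : LayerDominance) (hF : BarlowVirialSummable) (hSum : LayerDeltaSummable) :
    BarlowRegistryRigidity :=
  registryRigidityOfDominance_of_identity (layerVirialIdentity_of_summable hF hSum) hSum hD

/-- ★★ COROLLARY: [CLS] ⟸ [DOM] ∧ [VIR-fub] ∧ [VIR-sum]. -/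
theorem barlowStressFreeClassification_of_dominance_summable (hD : LayerDominance) (hF : BarlowVirialSummable) (hSum : LayerDeltaSummable) :
    BarlowStressFreeClassification :=
  barlowStressFreeClassification_of_dominance hD (registryRigidityOfDominance_of_identity (layerVirialIdentity_of_summable hF hSum) hSum)

end LayerRegrouping

end Summit.AtomisticToContinuum.Crystallization.Theorems.ChargedEnergyGapChartDial
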